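import Summits.AtomisticToContinuum.Crystallization.Theses.PalmUnimodularRigidity
import Literature.Probability.Process.PointStationaryLaw
import Literature.MathematicalPhysics.StatisticalMechanics.RootEnergy
import Literature.MathematicalPhysics.StatisticalMechanics.MuGSC

/-!
# Sharpening proposal for line `equilibrium-in-law-surgery` (crux `MinimiserShells`, stmt-AtomisticToContinuum-9225):
# the volume-growth stub S4 is ELIMINABLE

Finding of the deep-refute seat (not a refutation: S3/S4 are not false, they are STRONGER than the
composition needs).  The Palm step only needs the bad atoms to have ZERO RELATIVE DENSITY around the
root, not surface order `≤ C R²` plus cubic volume growth `≥ c R³` with uniform constants: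

* `PalmDensityLemma'` (replaces S6; still pure Palm theory, TRUE): if a point-stationary `δ`-hard-core
  probability law is a.s. carried by configurations `S` with
  `#bad(S ∩ B̄_R(0)) / #(S ∩ B̄_R(0)) → 0` (`R → ∞`), the root is a.s. good.
  PROOF (paper, for the prover).  Mecke with `g(μ,y) = 1[μ ∉ B]·1[‖y‖ ≤ R]·(μ(B̄(y,2R)))⁻¹`:
  out-mass `≥ 1[root bad]·N_R/N_{3R}` (`B̄(y,2R) ⊆ B̄(0,3R)` for `‖y‖ ≤ R`), in-mass
  `= #bad_R(0)/N_{2R} ≤ #bad_R(0)/N_R` (`θ_y μ (B̄(−y,2R)) = μ(B̄(0,2R))`), where `N_r = #(S ∩ B̄_r(0))`.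
  So `E[1[bad]·N_R/N_{3R}] ≤ ε(R) := E[#bad_R/N_R] → 0` (dominated by `1`).  Sum over `R = 3^k`,
  `k = 1..K`: by AM–GM and the hard-core PACKING bound `1 ≤ N_r ≤ C_δ r³` (no volume growth!),
  `Σ_k N_{3^k}/N_{3^{k+1}} ≥ K (N_3/N_{3^{K+1}})^{1/K} ≥ K/(27 (27 C_δ)^{1/K}) ≥ K/(729 C_δ)`, hence
  `P(bad) · K/(729 C_δ) ≤ Σ_{k ≤ K} ε(3^k) = o(K)`, i.e. `P(bad) = 0`.
* `DLRBadZeroDensity` (replaces S3 ∧ S4; implied by them, `badZeroDensity_of_surfaceOrder_of_volumeGrowth`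
  below): in every hard-core `e*`-μGSC the bad atoms have zero relative density around every atom.  No
  uniform constants, no quantitative capillarity; the qualitative exclusion of thin DLR-stable objects is
  still inside it (a 3-layer slab would have bad fraction `2/3`), as is the crux's physics.
* `MinimiserShells_of'` : the crux from FIVE statements (S1, 9229, `DLRBadZeroDensity`,
  `GoodShellMeasurable`, `PalmDensityLemma'`), real proof; vocabulary verbatim from the line.
-/

noncomputable section

open MeasureTheory Filter Topology
open scoped ENNReal BigOperators

namespace Summit.AtomisticToContinuum.Crystallization.Cruxes.MinimiserShells.Drefute.Sharpen

open Literature.Probability.Process (IsPointStationaryLaw IsRootedHardCore count_restrict_singleton_ne_zero_iff)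
open Literature.MathematicalPhysics.StatisticalMechanics
  (lennardJones PeriodicConfiguration IsMuGSC UniformlyDiscrete)
open Literature.Geometry.DiscreteGeometry (ShellCloseTo fccKissingPattern hcpKissingPattern)
open Summit.AtomisticToContinuum.Crystallization.Theses.PalmUnimodularRigidity
  (MinimiserShells UnimodularEnergyLowerBound)

/-- Ambient space `ℝ³`. -/
abbrev E3 := EuclideanSpace ℝ (Fin 3)

/-! ## The line's vocabulary (verbatim) -/

/-- `e*`. -/
def eStar : ℝ := ⨅ Q : PeriodicConfiguration 3, Q.energyPerParticle lennardJones
/-- `E_P[h]`. -/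
def meanRootEnergy (P : Measure (Measure E3)) : ℝ := ∫ μ, (∫ y, lennardJones ‖y‖ ∂μ) / 2 ∂P
/-- Root shell set. -/
def rootShellSet (μ : Measure E3) (a : ℝ) : Set E3 := {y | μ {y} ≠ 0 ∧ y ≠ 0 ∧ ‖y‖ ≤ 5 / 4 * a}
/-- Good root shell. -/
def GoodShell (μ : Measure E3) : Prop :=
  ∃ a : ℝ, 9 / 10 ≤ a ∧ a ≤ 1 ∧ ∃ T : Finset E3, (↑T : Set E3) = rootShellSet μ a ∧
    (ShellCloseTo (a / 100) T (Finset.image (fun v : E3 => a • v) fccKissingPattern) ∨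
      ShellCloseTo (a / 100) T (Finset.image (fun v : E3 => a • v) hcpKissingPattern))
/-- Good shell at `x ∈ S`. -/
def GoodShellIn (S : Set E3) (x : E3) : Prop :=
  GoodShell ((Measure.count : Measure E3).restrict ((fun y => y - x) '' S))

/-- READ-BACK (definitional). [folklore] -/
theorem minimiserShells_iff :
    MinimiserShells ↔ ∀ δ : ℝ, 0 < δ → ∀ P : Measure (Measure E3), IsProbabilityMeasure P →
      (∀ᵐ μ ∂P, IsRootedHardCore δ μ) → IsPointStationaryLaw P → meanRootEnergy P ≤ eStar →
      ∀ᵐ μ ∂P, GoodShell μ :=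
  Iff.rfl

/-- S1 (verbatim). -/
def EquilibriumInLaw : Prop :=
  UnimodularEnergyLowerBound →
    ∀ δ : ℝ, 0 < δ → ∀ P : Measure (Measure E3), IsProbabilityMeasure P →
      (∀ᵐ μ ∂P, IsRootedHardCore δ μ) → IsPointStationaryLaw P → meanRootEnergy P ≤ eStar →
      ∀ᵐ μ ∂P, ∃ S : Set E3, μ = (Measure.count : Measure E3).restrict S ∧ IsMuGSC lennardJones eStar S
/-- S3 (verbatim). -/
def DLRSurfaceOrder : Prop :=
  ∃ C : ℝ, ∀ S : Set E3, UniformlyDiscrete S → IsMuGSC lennardJones eStar S →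
    ∀ x ∈ S, ∀ R : ℝ, 1 ≤ R → ({y ∈ S | dist y x ≤ R ∧ ¬ GoodShellIn S y}.ncard : ℝ) ≤ C * R ^ 2
/-- S4 (verbatim). -/
def DLRVolumeGrowth : Prop :=
  ∃ c : ℝ, 0 < c ∧ ∀ S : Set E3, UniformlyDiscrete S → IsMuGSC lennardJones eStar S →
    ∀ x ∈ S, ∀ R : ℝ, 1 ≤ R → c * R ^ 3 ≤ ({y ∈ S | dist y x ≤ R}.ncard : ℝ)
/-- S5 (verbatim). -/
def GoodShellMeasurable : Prop :=
  ∃ B : Set (Measure E3), MeasurableSet B ∧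
    ∀ δ : ℝ, 0 < δ → ∀ μ : Measure E3, IsRootedHardCore δ μ → (μ ∈ B ↔ GoodShell μ)

/-! ## The sharpened statements -/

/-- Relative density of bad atoms of `S` in the closed ball of radius `R` about `x`
(`ncard/ncard`; `0` by junk division when the ball holds no atom, which never happens for `x ∈ S`). -/
def badFraction (S : Set E3) (x : E3) (R : ℝ) : ℝ :=
  ({y ∈ S | dist y x ≤ R ∧ ¬ GoodShellIn S y}.ncard : ℝ) / ({y ∈ S | dist y x ≤ R}.ncard : ℝ)

/-- **S3′ · DLRBadZeroDensity** (replaces S3 ∧ S4): in every hard-core `e*`-μGSC the bad atoms have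
zero relative density around every atom. -/
def DLRBadZeroDensity : Prop :=
  ∀ S : Set E3, UniformlyDiscrete S → IsMuGSC lennardJones eStar S →
    ∀ x ∈ S, Tendsto (fun R : ℝ => badFraction S x R) atTop (𝓝 0)

/-- **S6′ · PalmDensityLemma′** (replaces S6; TRUE — Mecke with `g = 1[bad]1[‖y‖≤R]/μ(B̄(y,2R))`,
AM–GM over the scales `3^k`, hard-core packing bound; see the module docstring). -/
def PalmDensityLemma' : Prop :=
  GoodShellMeasurable →
    ∀ δ : ℝ, 0 < δ → ∀ P : Measure (Measure E3), IsProbabilityMeasure P →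
      (∀ᵐ μ ∂P, IsRootedHardCore δ μ) → IsPointStationaryLaw P →
      (∀ᵐ μ ∂P, ∃ S : Set E3, μ = (Measure.count : Measure E3).restrict S ∧
          Tendsto (fun R : ℝ => badFraction S 0 R) atTop (𝓝 0)) →
      ∀ᵐ μ ∂P, GoodShell μ

/-! ## Real proofs: the old pair implies the new statement; the five-stub composition -/

/-- Counting measures determine their carrier. [folklore] -/
theorem eq_of_count_restrict_eq {S T : Set E3}
    (h : (Measure.count : Measure E3).restrict S = (Measure.count : Measure E3).restrict T) : S = T := by
  ext y
  rw [← count_restrict_singleton_ne_zero_iff S y, ← count_restrict_singleton_ne_zero_iff T y, h]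

/-- `S3 ∧ S4 ⇒ S3′`: surface order over cubic growth is `≤ (C/c)/R → 0`. [folklore] -/
theorem badZeroDensity_of_surfaceOrder_of_volumeGrowth (h3 : DLRSurfaceOrder) (h4 : DLRVolumeGrowth) :
    DLRBadZeroDensity := by
  obtain ⟨C, hC⟩ := h3
  obtain ⟨c, hc, hV⟩ := h4
  intro S hud hgsc x hx
  have hup : ∀ R : ℝ, 1 ≤ R → badFraction S x R ≤ C / c * R⁻¹ := by
    intro R hR
    have hR0 : 0 < R := by linarith
    have hN : c * R ^ 3 ≤ ({y ∈ S | dist y x ≤ R}.ncard : ℝ) := hV S hud hgsc x hx R hR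
    have hB : ({y ∈ S | dist y x ≤ R ∧ ¬ GoodShellIn S y}.ncard : ℝ) ≤ C * R ^ 2 :=
      hC S hud hgsc x hx R hR
    have hcR : 0 < c * R ^ 3 := by positivity
    have hNpos : 0 < ({y ∈ S | dist y x ≤ R}.ncard : ℝ) := lt_of_lt_of_le hcR hN
    have hCR : 0 ≤ C * R ^ 2 := le_trans (Nat.cast_nonneg _) hB
    unfold badFraction
    calc ({y ∈ S | dist y x ≤ R ∧ ¬ GoodShellIn S y}.ncard : ℝ) / ({y ∈ S | dist y x ≤ R}.ncard : ℝ)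
        ≤ C * R ^ 2 / ({y ∈ S | dist y x ≤ R}.ncard : ℝ) := div_le_div_of_nonneg_right hB hNpos.le
      _ ≤ C * R ^ 2 / (c * R ^ 3) := div_le_div_of_nonneg_left hCR hcR hN
      _ = C / c * R⁻¹ := by field_simp
  have hlow : ∀ R : ℝ, 0 ≤ badFraction S x R := fun R => by unfold badFraction; positivity
  have hlim : Tendsto (fun R : ℝ => C / c * R⁻¹) atTop (𝓝 0) := by
    simpa using tendsto_inv_atTop_zero.const_mul (C / c)
  refine tendsto_of_tendsto_of_tendsto_of_le_of_le' tendsto_const_nhds hlim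
    (Eventually.of_forall hlow) ?_
  filter_upwards [eventually_ge_atTop (1 : ℝ)] with R hR using hup R hR

/-- **The crux from five statements** (S4 eliminated, S3 weakened to zero relative density, S6 replaced by
S6′): `EquilibriumInLaw → UnimodularEnergyLowerBound → DLRBadZeroDensity → GoodShellMeasurable →
PalmDensityLemma′ → MinimiserShells`, real proof. -/
theorem MinimiserShells_of' :
    EquilibriumInLaw → UnimodularEnergyLowerBound → DLRBadZeroDensity → GoodShellMeasurable →
      PalmDensityLemma' → MinimiserShells := by
  intro hEq hFloor hZero hMeas hPalm
  rw [minimiserShells_iff]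
  intro δ hδ P hP hcore hstat hE
  have hdlr := hEq hFloor δ hδ P hP hcore hstat hE
  refine hPalm hMeas δ hδ P hP hcore hstat ?_
  filter_upwards [hcore, hdlr] with μ hμ hd
  obtain ⟨S, h0, hsep, rfl⟩ := hμ
  obtain ⟨T, hT, hgsc⟩ := hd
  obtain rfl : S = T := eq_of_count_restrict_eq hT
  exact ⟨S, rfl, hZero S ⟨δ, hδ, hsep⟩ hgsc 0 h0⟩

/-- The old six-stub line implies the new five-stub line's deterministic input. [folklore] -/
theorem MinimiserShells_of_old (hEq : EquilibriumInLaw) (hFloor : UnimodularEnergyLowerBound)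
    (h3 : DLRSurfaceOrder) (h4 : DLRVolumeGrowth) (hMeas : GoodShellMeasurable)
    (hPalm : PalmDensityLemma') : MinimiserShells :=
  MinimiserShells_of' hEq hFloor (badZeroDensity_of_surfaceOrder_of_volumeGrowth h3 h4) hMeas hPalm

end Summit.AtomisticToContinuum.Crystallization.Cruxes.MinimiserShells.Drefute.Sharpen

end
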